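import Literature.LinearAlgebra.Matrix.PosDefHermitianPairDiagonalization
import Mathlib.Analysis.Matrix.Order
import HarnessLib

/-!
# `A(I - A)⁻¹ ≤ B(I - B)⁻¹` for `A ≤ B < I` (Borcea–Brändén–Liggett, Lemma 4.14)

J. Borcea, P. Brändén, T. M. Liggett, *Negative dependence and the geometry of polynomials*, J. Amer. Math.
Soc. 22 (2009) 521–567 (arXiv:0707.2340, held `paper:arxiv-0707.2340`; numbering of the arXiv version), §4.3.1
(the matrix lemma behind Thm. 4.13, the extension of Lyons' stochastic domination theorem for determinantal
measures to the Loewner order). Verbatim: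

> Recall that the standard partial order on the set of all Hermitian `n × n` matrices – often referred to as the
> Loewner order – is induced by the cone of all positive semi-definite `n × n` matrices: `A ≤ B` (respectively,
> `A < B`) means that `B - A` is positive semi-definite (respectively, positive definite). […]
> **Lemma 4.14.** If `A, B` are positive semi-definite `n × n` matrices such that `A ≤ B < I` then
> `A(I-A)⁻¹ ≤ B(I-B)⁻¹`.
> *Proof.* By a standard density argument it is enough to prove the lemma for positive definite matrices. Note
> first that if `C` is a positive definite `n × n` matrix such that `C ≤ I` then `C⁻¹ ≥ I`. Moreover, if `D` is a
> positive definite `n × n` matrix such that `C ≤ D` then `M* C M ≤ M* D M` for any `n × n` matrix `M` […] we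
> obtain `C⁻¹ ≥ D⁻¹`. Therefore, if `A, B` are positive definite matrices as in the lemma it follows that
> `I - A⁻¹ ≤ I - B⁻¹`, hence `A(I-A)⁻¹ = -(I - A⁻¹)⁻¹ ≤ -(I - B⁻¹)⁻¹ = B(I-B)⁻¹`. □

## Route

Matrices over `𝕜 = ℝ` or `ℂ` (`RCLike`) with Mathlib's Loewner order (`Matrix.le_iff : A ≤ B ↔ (B - A).PosSemidef`,
scoped `MatrixOrder`). The antitonicity of inversion on positive definite matrices ("`C ≤ D` then `C⁻¹ ≥ D⁻¹`")
is the tree's Horn–Johnson Corollary 7.7.4 (a) (`sub_posSemidef_iff_inv_sub_inv_posSemidef`,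
`PosDefHermitianPairDiagonalization.lean`). With the identity `A(I-A)⁻¹ = (I-A)⁻¹ - I` the lemma is this
antitonicity applied to `I - B ≤ I - A`; no density argument is needed and `A ⪰ 0` is not used.

## Contents

* `posDef_one_sub_of_le`, `mul_inv_one_sub_eq_inv_sub_one`, `inv_sub_inv_posSemidef_of_posDef` (`0 ≺ C ≤ D ⟹ D⁻¹ ≤ C⁻¹`),
  **`BorceaBrandenLiggett_lemma_4_14`** (`PosSemidef` form) and **`BorceaBrandenLiggett_lemma_4_14'`** (Loewner
  `≤` form).

## References

* [BorceaBrandenLiggett2007] J. Borcea, P. Brändén, T. M. Liggett, Negative dependence and the geometry of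
  polynomials, J. Amer. Math. Soc. 22 (2009), 521–567; arXiv:0707.2340 — §4.3.1 Lemma 4.14.
-/

noncomputable section

open Matrix
open scoped ComplexOrder MatrixOrder

namespace Literature.LinearAlgebra.Matrix

variable {𝕜 : Type*} [RCLike 𝕜] {n : Type*} [Fintype n] [DecidableEq n]

omit [Fintype n] in
/-- `I - A` is positive definite when `A ≤ B` and `I - B` is positive definite. [cite: BorceaBrandenLiggett2007,
§4.3.1 proof of Lemma 4.14] -/
theorem posDef_one_sub_of_le {A B : Matrix n n 𝕜} (hAB : (B - A).PosSemidef) (hB : (1 - B).PosDef) :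
    (1 - A).PosDef := by
  have h : (1 - A : Matrix n n 𝕜) = (1 - B) + (B - A) := by abel
  rw [h]
  exact hB.add_posSemidef hAB

/-- `A (I - A)⁻¹ = (I - A)⁻¹ - I` when `I - A` is invertible. [cite: BorceaBrandenLiggett2007, §4.3.1 proof of
Lemma 4.14 ("`A(I-A)⁻¹ = -(I - A⁻¹)⁻¹`")] -/
theorem mul_inv_one_sub_eq_inv_sub_one {A : Matrix n n 𝕜} (h : IsUnit (1 - A : Matrix n n 𝕜).det) :
    A * (1 - A)⁻¹ = (1 - A)⁻¹ - 1 := by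
  have h1 : (1 - A) * (1 - A)⁻¹ = (1 : Matrix n n 𝕜) := Matrix.mul_nonsing_inv _ h
  have h2 : A * (1 - A)⁻¹ = (1 - (1 - A)) * (1 - A)⁻¹ := by rw [sub_sub_cancel]
  rw [h2, sub_mul, one_mul, h1]

/-- **Inverting reverses the Loewner order** on positive definite matrices: `0 ≺ C ≤ D ⟹ D⁻¹ ≤ C⁻¹` (the tree's
Horn–Johnson Cor. 7.7.4 (a), `sub_posSemidef_iff_inv_sub_inv_posSemidef`, with `D ≻ 0` derived).
[cite: BorceaBrandenLiggett2007, §4.3.1 proof of Lemma 4.14 ("if `C ≤ D` then … `C⁻¹ ≥ D⁻¹`")] -/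
theorem inv_sub_inv_posSemidef_of_posDef {C D : Matrix n n 𝕜} (hC : C.PosDef) (hCD : (D - C).PosSemidef) :
    (C⁻¹ - D⁻¹).PosSemidef := by
  have hD : D.PosDef := by
    have h : D = C + (D - C) := by abel
    rw [h]
    exact hC.add_posSemidef hCD
  exact (sub_posSemidef_iff_inv_sub_inv_posSemidef hD hC).1 hCD

/-- **Borcea–Brändén–Liggett, Lemma 4.14.** "If `A, B` are positive semi-definite `n × n` matrices such that
`A ≤ B < I` then `A(I-A)⁻¹ ≤ B(I-B)⁻¹`" (Loewner order; `<` = positive definite difference). Proof: `A(I-A)⁻¹ =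
(I-A)⁻¹ - I`, and `I - B ≤ I - A` are positive definite, so their inverses compare the other way (BBL reduce to
positive definite `A, B` by density and invert twice; the identity `A(I-A)⁻¹ = (I-A)⁻¹ - I` makes this unnecessary
— positive semidefiniteness of `A` is not even used). [cite: BorceaBrandenLiggett2007, §4.3.1 Lemma 4.14] -/
theorem BorceaBrandenLiggett_lemma_4_14 {A B : Matrix n n 𝕜} (hAB : (B - A).PosSemidef) (hB : (1 - B).PosDef) :
    (B * (1 - B)⁻¹ - A * (1 - A)⁻¹).PosSemidef := by
  have hA1 : (1 - A).PosDef := posDef_one_sub_of_le hAB hB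
  rw [mul_inv_one_sub_eq_inv_sub_one ((Matrix.isUnit_iff_isUnit_det _).1 hA1.isUnit),
    mul_inv_one_sub_eq_inv_sub_one ((Matrix.isUnit_iff_isUnit_det _).1 hB.isUnit), sub_sub_sub_cancel_right]
  refine inv_sub_inv_posSemidef_of_posDef hB ?_
  have h : (1 - A) - (1 - B) = B - A := by abel
  rw [h]
  exact hAB

/-- Lemma 4.14 in Loewner-order notation (`open scoped MatrixOrder`): `A ≤ B`, `I - B ≻ 0` `⟹`
`A(I-A)⁻¹ ≤ B(I-B)⁻¹`. [cite: BorceaBrandenLiggett2007, §4.3.1 Lemma 4.14] -/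
theorem BorceaBrandenLiggett_lemma_4_14' {A B : Matrix n n 𝕜} (hAB : A ≤ B) (hB : (1 - B).PosDef) :
    A * (1 - A)⁻¹ ≤ B * (1 - B)⁻¹ :=
  Matrix.le_iff.2 (BorceaBrandenLiggett_lemma_4_14 (Matrix.le_iff.1 hAB) hB)

end Literature.LinearAlgebra.Matrix

end
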